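import Summits.BirchSwinnertonDyer.Rank1Residual.X11b.BDPRouteOpenInputFieldPrint
import Summits.BirchSwinnertonDyer.Rank1Residual.X11b.BDPRouteOpenInputSplitRecord
import Summits.BirchSwinnertonDyer.Rank1Residual.X11b.BDPRouteOpenInputFromLever
import HarnessLib

/-!
# Class X11b, route p2 at `p ≥ 5`: THE OPEN STATEMENT AT ITS WEAKEST IN THE DATUM DIRECTION (IV) —
# THE SEMISTABLE END STATE from published + cited facts and (2.4)∃♭ over ONE admissible Heegner field
# (or over the Hoffstein–Luo fields with any prescribed finite set of split primes), plus — off the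
# Locus only — one certificate (cell `b2b-bsdres`, sub-cell `multr1-p2`, gen 27; file 4 of 4)

HONEST FRAMING (cell `b2b-bsdres`, run/shared/lean/b2b/bsd-rank1-residual/, verbatim in every
file): the goal of the cell is to DELETE the COMBINATION-SHAPED residual classes of the
Birch–Swinnerton-Dyer formula for ALL analytic-rank `≤ 1` elliptic curves over `ℚ` — "full BSD
formula for every rank `≤ 1` curve in class `C`" assembled STRICTLY from published theorems — so
that the rank-`≤ 1` remainder becomes exactly the CONSTRUCTION-SHAPED classes, which are TYPED
(missing-input `Prop`s), NOT attempted. This is not "finishing BSD". Sub-cell `multr1-p2` is a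
RESEARCH ROUTE on class X11b (`ClassX11b W p := r_an = 1 ∧ p ≠ 2 ∧ mult(p) ∧ irr(p)`); no claim
beyond the stated class and loci; X11b's label does not change; NOTHING is booked by this file.

THEOREMS ONLY (no definition, no named fact, no `sorry`).

## What this file proves

* **`P2.bsdp_of_semistable_of_imcDivSomeFrameAtField`** — gen 25's SEMISTABLE END STATE
  `P2.bsdp_of_semistable_of_imcDivSomeFrame` with THE open statement asked over ONE admissible field:
  for every semistable X11b pair at `p ≥ 5` (753 185 ‖ 30 086), `BSD(E,p)` from route p2's and the
  lever's published named facts (+ Kolyvagin 1990 Thm. A, Cas18 Thms. 3.1–3.2 `h32`), the CITED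
  Poitou–Tate / local Euler characteristic, **(2.4)∃♭ over ONE imaginary quadratic `K` with `d_K`
  odd, `p ∤ d_K`, `p ∤ w_K`, every `ℓ ∣ N_E` split, `L(E^{d_K},1) ≠ 0`**, and — OFF the Locus only
  (30 041 pairs) — ONE certificate: the `p`-adic height (REG) or, when `p ∤ ∏c`, a twist certificate
  (TC, at a field of its own). Lower half: file 3's `P2.openInputOnTreeAtField_of_someFrames` (value
  from `h32`) + file 1's `P2.missingLowerBoundAt_of_openInputAtField`; upper half: the Locus THEOREM
  `missingUpperBoundAt_of_classX11b_of_ram_of_not_dvd`, or gen 21's lever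
  `missingUpperBoundAt_of_katoSurj_of_regulatorNonvanishing` (Disegni's (∗) automatic on semistable
  pairs), or gen 22's `missingUpperBoundAt_of_classX11b_of_twistUnit`.
* **`P2.bsdp_of_semistable_of_imcDivSomeFrame_prescribedFields`** — the same with (2.4)∃♭ asked over
  every imaginary quadratic `K` with `d_K ≡ 1 (mod 8)`, `|d_K| > B`, the primes of a finite set `S`
  (and of `N_E p`) split and `L(E^{d_K},1) ≠ 0`, for ANY `S`, `B` (file 2's Hoffstein–Luo supply).

* `P2.openInputOnTreeAt_of_imcDivSomeFrameAtField_of_semistable_locus` — on a semistable Locus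
  pair, with Cas18 Thm. 2.3 (`h23`) for the control identity: (2.4)∃♭ over ONE admissible field ⟹
  `BSD(E,p)` ∧ the class-wide composite open input over EVERY field.

Reading (registry only; nothing filed): the semistable attach point of route p2 is now "(2.4) for
SOME frame over SOME admissible field (or over the Hoffstein–Luo fields with the source's local
conditions)"; with gen 26 it sees neither the frame, nor the receptacle, nor the field. CONDITIONAL
on (2.4)∃♭ (PRE at `p ∥ N`) and the certificates; nothing booked; labels UNCHANGED; X11b stays
CONSTRUCTION-SHAPED.

## References

* [Castella2018] Thm. 2.3, Thms. 3.1–3.2, §5 (arXiv:1704.06608 pp. 5, 9, 12).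
* [Castella2018Erratum] (2.4), Thm. 1.1 (pp. 1, 4). * [HoffsteinLuo1997] Theorem.
* [Skinner2016PacificMC] Thm. C (§1). * [McCallumLMS1991] §1 Theorem (Kolyvagin), p. 296.
* [Disegni2020] Thm. 1 (§1.2), (∗). * [Wuthrich2014] Thm. 3 (p. 383), Prop. 21 (p. 400).
* [SteinWuthrich2013] Thm. 6.1, §4.2.
-/

noncomputable section

open scoped Classical NumberField

open WeierstrassCurve NumberField IsDedekindDomain Field PowerSeries
open Literature.NumberTheory.EllipticCurves Literature.NumberTheory.EllipticCurves.GreenbergSelmer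
open Literature.NumberTheory.EllipticCurves.ModularForms
open Literature.NumberTheory.EllipticCurves.Rank1Residual
open Literature.NumberTheory.EllipticCurves.Rank1Residual.Typed
open Literature.NumberTheory.EllipticCurves.Wuthrich2014
open Literature.NumberTheory.EllipticCurves.Castella2018
open Literature.NumberTheory.EllipticCurves.SteinWuthrich2013
open Literature.NumberTheory.EllipticCurves.Disegni2020
open Literature.NumberTheory.EllipticCurves.Skinner2016
open Literature.NumberTheory.EllipticCurves.BalakrishnanEtAl2019
open Literature.NumberTheory.QuadraticFields.Quadratic
open Literature.NumberTheory.GaloisRepresentations Literature.NumberTheory.GaloisCohomology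
open Summit.BirchSwinnertonDyer.Rank1Residual.X11b.AcSelmer
open Summit.BirchSwinnertonDyer.Rank1Residual.X11b.Halves

namespace Summit.BirchSwinnertonDyer.Rank1Residual.X11b

variable (W : WeierstrassCurve ℚ) [W.IsElliptic] [W.IsGloballyMinimal] (p : ℕ) [Fact p.Prime]

/-- **SEMISTABLE END STATE OVER ONE FIELD.** Every semistable X11b pair at `p ≥ 5`: `BSD(E,p)` from
route p2's and the lever's published named facts, `h32`, the cited `hPT`/`hEP`, THE open statement
(2.4)∃♭ over ONE admissible field `K₀`, and — OFF the Locus only — one certificate (REG, or TC when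
`p ∤ ∏c`, the twist certificate living at a field of its own). See the module docstring.
CONDITIONAL on (2.4)∃♭ over `K₀` (OPEN) and the certificate; nothing booked.
[cite: Castella2018Erratum, (2.4), Thm. 1.1 (pp. 1, 4)] [cite: Castella2018, Thms. 2.3, 3.1, 3.2, §5]
[cite: Skinner2016PacificMC, Thm. C (§1)] [cite: McCallumLMS1991, §1 Theorem (Kolyvagin), p. 296]
[cite: Disegni2020, Thm. 1 (§1.2), (∗)] [cite: Wuthrich2014, Thm. 3 (p. 383), Prop. 21 (p. 400)]
[cite: SteinWuthrich2013, Thm. 6.1, §4.2] [cite: Miller2011LMS, Def. 1.1] -/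
theorem P2.bsdp_of_semistable_of_imcDivSomeFrameAtField
    -- route p2's published inputs
    (hGZ : ∀ (N : ℕ) [NeZero N] (W : WeierstrassCurve ℚ) (K : Type) [Field K] [NumberField K],
      gross_zagier N W K)
    (hKo : ∀ (N : ℕ) [NeZero N] (W : WeierstrassCurve ℚ) (K : Type) [Field K] [NumberField K],
      kolyvagin N W K)
    (hB : ∀ (N : ℕ) [NeZero N] (W : WeierstrassCurve ℚ) (K : Type) [Field K] [NumberField K],
      Kolyvagin1990_padicValNat_card_sha_le N W K)
    (hSk : Skinner2016.thmC_padicValRat_bsd_rank_zero) (hWu : sha_dvd_analyticSha)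
    (hGZK : rank_eq_analyticRank_of_analyticRank_le_one) (hnf : exists_isNewformOf)
    (hHL : HoffsteinLuo1997_exists_twist_L_one_ne_zero) (hMaz : mazur_not_dvd_maninConstant_of_odd)
    (hPT : ∀ (K : Type) [Field K] [NumberField K], poitouTate_sum_localTatePairing_eq_zero K)
    (hEP : ∀ (K : Type) [Field K] [NumberField K] (v : HeightOneSpectrum (𝓞 K)),
      localEulerPoincareCharacteristic (v.adicCompletion K))
    -- Castella 2018 Thms. 3.1–3.2 (PUBLISHED; semistable scope)
    (h32 : thm32_exists_isBDPLFunction_valueAtOne)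
    -- the lever's published inputs
    (hK : kato_charIdeal_dvd_multiplicative_of_surjective)
    (hJn : thm61_nonsplitMultiplicative) (hJs : thm61_splitMultiplicative)
    (hHn : exists_isMultCanonical) (hHs : exists_isSplitMultCanonical)
    (hD : thm1_padicBSD_rankOne_multiplicative) (hpar : nonempty_modularParametrizationData)
    -- the pair: semistable X11b, `p ≥ 5`
    (hss : Semistable W) (hX : ClassX11b W p) (hp5 : 5 ≤ p)
    -- ONE admissible field and THE open statement over it
    {K₀ : Type} [Field K₀] [NumberField K₀]
    (hK₀ : IsImaginaryQuadratic K₀) (hodd : Odd (NumberField.discr K₀))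
    (hpd : ¬ (p : ℤ) ∣ NumberField.discr K₀) (hμ : ¬ p ∣ Units.torsionOrder K₀)
    (hHN₀ : SatisfiesHeegnerHypothesis (W.conductorNorm ℤ) K₀)
    (hLt₀ : (W.quadraticTwist (NumberField.discr K₀ : ℚ)).entireLFunction 1 ≠ 0)
    (hDiv : P2.IMCDivSomeFrameOnTreeAtField W p K₀)
    -- OFF the Locus: ONE certificate — the `p`-adic height, or (`p ∤ ∏c`) a twist certificate
    (hcert : ¬ (Ram W p ∧ ¬ p ∣ W.tamagawaProduct) →
      ClassClosure.RegulatorNonvanishingAt W p ∨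
      (¬ p ∣ W.tamagawaProduct ∧
        ∃ (K : Type) (_ : Field K) (_ : NumberField K) (Wd : WeierstrassCurve ℚ) (_ : Wd.IsElliptic)
          (_ : Wd.IsGloballyMinimal) (Cd : VariableChange ℚ) (qd : ℚ),
          IsImaginaryQuadratic K ∧ SatisfiesHeegnerHypothesis (W.conductorNorm ℤ) K ∧
          NumberField.discr K < -4 ∧ Cd • W.quadraticTwist (NumberField.discr K : ℚ) = Wd ∧
          Wd.entireLFunction 1 / (Wd.realPeriodRat : ℂ) = (qd : ℂ) ∧ qd ≠ 0 ∧ padicValRat p qd = 0)) :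
    BSDp W p := by
  have hmod : hasEntireLFunction_rat := hasEntireLFunction_rat_of_exists_isNewformOf hnf
  have hsurj : Surj W p := surj_of_irr_of_semistable W p hX.2.2.2 hss
  -- the main-conjecture half from (2.4)∃♭ over `K₀` (value from `h32`)
  have hlow : Typed.MissingLowerBoundAt W p :=
    P2.missingLowerBoundAt_of_openInputAtField W p hGZ hKo hWu hGZK hmod hnf hMaz hPT hEP hK₀ hodd hpd
      hμ hHN₀ hLt₀
      (P2.openInputOnTreeAtField_of_someFrames hnf hGZK hKo hPT hEP hDiv
        (P2.bdpValueSomeFrameOnTreeAtField_of_thm32_of_semistable h32 hss))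
      hX hp5 hsurj
  -- the Euler-system half: theorem on the Locus, one certificate off it
  have hup : Typed.MissingUpperBoundAt W p := by
    by_cases hloc : Ram W p ∧ ¬ p ∣ W.tamagawaProduct
    · exact missingUpperBoundAt_of_classX11b_of_ram_of_not_dvd hGZ hKo hB hSk hGZK hmod hnf hHL hMaz
        integral_neronScaling_of_isGloballyMinimal_holds W p hX hloc.1 hloc.2
    · rcases hcert hloc with hReg | ⟨htam, K, _, _, Wd, _, _, Cd, qd, hK', hHN, hdK, hWd, hqd, hqd0, hvd⟩
      · exact missingUpperBoundAt_of_katoSurj_of_regulatorNonvanishing W p hK hJn hJs hHn hHs hD hGZK hpar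
          hp5 hX.2.2.1 hX.1 hsurj (disegniStar_of_classX11b_of_semistable hnf hX hss) hReg
      · exact missingUpperBoundAt_of_classX11b_of_twistUnit W p hGZ hKo hB hGZK hmod hnf hMaz hX hp5 hsurj
          htam K hK' hHN hdK Wd Cd hWd qd hqd hqd0 hvd
  exact Typed.bsdp_of_missingPPartAt W p hGZK (by rw [hX.1])
    (Typed.missingPPartAt_of_lower_of_upper W p hlow hup)

/-- **SEMISTABLE END STATE OVER THE PRESCRIBED FIELDS.** As above, with (2.4)∃♭ asked over every
imaginary quadratic `K` with `d_K ≡ 1 (mod 8)`, `|d_K| > B`, the primes of `S` (and of `N_E p`) split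
and `L(E^{d_K},1) ≠ 0` — ANY finite set `S` of primes and bound `B`; Hoffstein–Luo supplies the field
(file 2). CONDITIONAL on (2.4)∃♭ over those fields and the certificate; nothing booked.
[cite: HoffsteinLuo1997, Theorem] [cite: Castella2018Erratum, (2.4), Thm. 1.1 (pp. 1, 4)]
[cite: Castella2018, Thms. 2.3, 3.1, 3.2, §5] [cite: Skinner2016PacificMC, Thm. C (§1)]
[cite: Disegni2020, Thm. 1 (§1.2), (∗)] [cite: Wuthrich2014, Thm. 3 (p. 383), Prop. 21 (p. 400)] -/
theorem P2.bsdp_of_semistable_of_imcDivSomeFrame_prescribedFields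
    -- route p2's published inputs
    (hGZ : ∀ (N : ℕ) [NeZero N] (W : WeierstrassCurve ℚ) (K : Type) [Field K] [NumberField K],
      gross_zagier N W K)
    (hKo : ∀ (N : ℕ) [NeZero N] (W : WeierstrassCurve ℚ) (K : Type) [Field K] [NumberField K],
      kolyvagin N W K)
    (hB : ∀ (N : ℕ) [NeZero N] (W : WeierstrassCurve ℚ) (K : Type) [Field K] [NumberField K],
      Kolyvagin1990_padicValNat_card_sha_le N W K)
    (hSk : Skinner2016.thmC_padicValRat_bsd_rank_zero) (hWu : sha_dvd_analyticSha)
    (hGZK : rank_eq_analyticRank_of_analyticRank_le_one) (hnf : exists_isNewformOf)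
    (hHL : HoffsteinLuo1997_exists_twist_L_one_ne_zero) (hMaz : mazur_not_dvd_maninConstant_of_odd)
    (hPT : ∀ (K : Type) [Field K] [NumberField K], poitouTate_sum_localTatePairing_eq_zero K)
    (hEP : ∀ (K : Type) [Field K] [NumberField K] (v : HeightOneSpectrum (𝓞 K)),
      localEulerPoincareCharacteristic (v.adicCompletion K))
    (h32 : thm32_exists_isBDPLFunction_valueAtOne)
    (hK : kato_charIdeal_dvd_multiplicative_of_surjective)
    (hJn : thm61_nonsplitMultiplicative) (hJs : thm61_splitMultiplicative)
    (hHn : exists_isMultCanonical) (hHs : exists_isSplitMultCanonical)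
    (hD : thm1_padicBSD_rankOne_multiplicative) (hpar : nonempty_modularParametrizationData)
    (hss : Semistable W) (hX : ClassX11b W p) (hp5 : 5 ≤ p)
    -- the source's hypotheses on the field: a finite set of split primes and a bound
    (S : Finset ℕ) (hS : ∀ q ∈ S, q.Prime) (B : ℕ)
    -- THE open statement, over the prescribed fields only
    (hDiv : ∀ (K : Type) [Field K] [NumberField K], IsImaginaryQuadratic K →
      NumberField.discr K % 8 = 1 → B < (NumberField.discr K).natAbs →
      (∀ q ∈ S, SatisfiesHeegnerHypothesis q K) →
      (W.quadraticTwist (NumberField.discr K : ℚ)).entireLFunction 1 ≠ 0 →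
      P2.IMCDivSomeFrameOnTreeAtField W p K)
    (hcert : ¬ (Ram W p ∧ ¬ p ∣ W.tamagawaProduct) →
      ClassClosure.RegulatorNonvanishingAt W p ∨
      (¬ p ∣ W.tamagawaProduct ∧
        ∃ (K : Type) (_ : Field K) (_ : NumberField K) (Wd : WeierstrassCurve ℚ) (_ : Wd.IsElliptic)
          (_ : Wd.IsGloballyMinimal) (Cd : VariableChange ℚ) (qd : ℚ),
          IsImaginaryQuadratic K ∧ SatisfiesHeegnerHypothesis (W.conductorNorm ℤ) K ∧
          NumberField.discr K < -4 ∧ Cd • W.quadraticTwist (NumberField.discr K : ℚ) = Wd ∧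
          Wd.entireLFunction 1 / (Wd.realPeriodRat : ℂ) = (qd : ℂ) ∧ qd ≠ 0 ∧ padicValRat p qd = 0)) :
    BSDp W p := by
  have hr : W.analyticRank = 1 := hX.1
  have hp2 : p ≠ 2 := hX.2.1
  have hw : W.rootNumber = -1 := by
    rw [WeierstrassCurve.rootNumber_eq_neg_one_pow_analyticRank_of_exists_isNewformOf hnf W, hr]
    norm_num
  obtain ⟨K₀, _, _, hK₀, hd8, hBK, hHN₀, hHp, hHS, hLt₀⟩ :=
    exists_admissibleField_splitAt W p hnf hHL hw S hS (max B 4)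
  have hB' : B < (NumberField.discr K₀).natAbs := lt_of_le_of_lt (le_max_left _ _) hBK
  have h4 : 4 < (NumberField.discr K₀).natAbs := lt_of_le_of_lt (le_max_right _ _) hBK
  obtain ⟨hodd, hpd, hμ⟩ := admissible_of_discr_mod_eight p hK₀ hd8 h4 hp2 hHp
  exact P2.bsdp_of_semistable_of_imcDivSomeFrameAtField W p hGZ hKo hB hSk hWu hGZK hnf hHL hMaz hPT hEP
    h32 hK hJn hJs hHn hHs hD hpar hss hX hp5 hK₀ hodd hpd hμ hHN₀ hLt₀ (hDiv K₀ hK₀ hd8 hB' hHS hLt₀)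
    hcert

/-- **ON A SEMISTABLE LOCUS PAIR: (2.4)∃♭ over ONE admissible field ⟹ `BSD(E,p)` ⟹ route p2's
composite open input over EVERY field** — everything sourced but (2.4): the published facts, `h32`
(Cas18 Thms. 3.1–3.2) for the value, and Cas18 Thm. 2.3 (`h23`, PUBLISHED; semistable scope) for the
control IDENTITY used in the second implication (gen 21's `p2ControlOnTreeAt_of_thm23_of_semistable`,
gen 18's rigidity `P2.openInputOnTreeAt_of_bsdp_of_ram`). So on the 723 144 semistable Locus pairs
the open statement over one field and the class-wide composite input over all fields stand or fall
together with `BSD(E,p)`. CONDITIONAL on (2.4)∃♭ over `K₀`; nothing booked.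
[cite: Castella2018, Thm. 2.3 (p. 5), Thms. 3.1–3.2 (p. 9), §5 (p. 12)]
[cite: Castella2018Erratum, (2.4) (p. 4)] [cite: Skinner2016PacificMC, Thm. C (§1)] -/
theorem P2.openInputOnTreeAt_of_imcDivSomeFrameAtField_of_semistable_locus
    (hGZ : ∀ (N : ℕ) [NeZero N] (W : WeierstrassCurve ℚ) (K : Type) [Field K] [NumberField K],
      gross_zagier N W K)
    (hKo : ∀ (N : ℕ) [NeZero N] (W : WeierstrassCurve ℚ) (K : Type) [Field K] [NumberField K],
      kolyvagin N W K)
    (hB : ∀ (N : ℕ) [NeZero N] (W : WeierstrassCurve ℚ) (K : Type) [Field K] [NumberField K],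
      Kolyvagin1990_padicValNat_card_sha_le N W K)
    (hSk : Skinner2016.thmC_padicValRat_bsd_rank_zero) (hWu : sha_dvd_analyticSha)
    (hGZK : rank_eq_analyticRank_of_analyticRank_le_one) (hnf : exists_isNewformOf)
    (hHL : HoffsteinLuo1997_exists_twist_L_one_ne_zero) (hMaz : mazur_not_dvd_maninConstant_of_odd)
    (hPT : ∀ (K : Type) [Field K] [NumberField K], poitouTate_sum_localTatePairing_eq_zero K)
    (hEP : ∀ (K : Type) [Field K] [NumberField K] (v : HeightOneSpectrum (𝓞 K)),
      localEulerPoincareCharacteristic (v.adicCompletion K))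
    -- Castella 2018 Thms. 3.1–3.2 and Thm. 2.3 (PUBLISHED; semistable scope)
    (h32 : thm32_exists_isBDPLFunction_valueAtOne) (h23 : thm23_anticyclotomicControl)
    (hss : Semistable W)
    -- ONE admissible field and THE open statement over it
    {K₀ : Type} [Field K₀] [NumberField K₀]
    (hK₀ : IsImaginaryQuadratic K₀) (hodd : Odd (NumberField.discr K₀))
    (hpd : ¬ (p : ℤ) ∣ NumberField.discr K₀) (hμ : ¬ p ∣ Units.torsionOrder K₀)
    (hHN₀ : SatisfiesHeegnerHypothesis (W.conductorNorm ℤ) K₀)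
    (hLt₀ : (W.quadraticTwist (NumberField.discr K₀ : ℚ)).entireLFunction 1 ≠ 0)
    (hDiv : P2.IMCDivSomeFrameOnTreeAtField W p K₀)
    -- the pair: on the Locus
    (hX : ClassX11b W p) (hp5 : 5 ≤ p) (hram : Ram W p) (htam : ¬ p ∣ W.tamagawaProduct) :
    BSDp W p ∧ P2OpenInputOnTreeAt W p := by
  have hmod : hasEntireLFunction_rat := hasEntireLFunction_rat_of_exists_isNewformOf hnf
  have hbsd : BSDp W p :=
    P2.bsdp_of_semistable_locus_of_imcDivSomeFrameAtField hGZ hKo hB hSk hWu hGZK hnf hHL hMaz hPT hEP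
      h32 hss hK₀ hodd hpd hμ hHN₀ hLt₀ hDiv hX hp5 hram htam
  exact ⟨hbsd, P2.openInputOnTreeAt_of_bsdp_of_ram W p hGZ hKo hSk hGZK hmod
    (p2ControlOnTreeAt_of_thm23_of_semistable W p h23 hKo hss) hram hbsd⟩

end Summit.BirchSwinnertonDyer.Rank1Residual.X11b

end
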